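import Mathlib
import Literature.Geometry.Riemannian.SphericalCylinderEntropy
import Literature.Geometry.Manifold.CylinderSlice
import Literature.Geometry.Riemannian.SphericalZonalHamiltonHarnack
import HarnessLib

/-!
# Stub `stub_hamiltonConvex`: Hamilton's logarithmic convexity for the zonal heat kernel of `S⁴`

Stub `stub_hamiltonConvex` of line `ball-mass-slack` of the crux `CylinderEntropy.ThinCrossSectionExists`
(`stmt-SmoothPoincare4-7633`), proved with its registered statement verbatim: for every `τ > 0` the
typed zonal heat kernel `θ ↦ zonal τ (cos θ)` of the round `S⁴` is positive and
`θ ↦ log (zonal τ (cos θ)) + θ²/(4τ)` is convex on `[-π, π]` (R. S. Hamilton's matrix Harnack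
estimate, Comm. Anal. Geom. 1 (1993), in radial form).  The whole proof lives in the Literature tree:
`Literature.Geometry.Riemannian.SphericalZonalKernelSeries.hamiltonLogConvex_zonal`
(`SphericalZonalHamiltonHarnack.lean`: Li–Yau–Hamilton maximum principle for the positive polynomial
Gegenbauer heat flows, `HamiltonHarnackRadialSphereFour.lean`, `GegenbauerHeatHarnack.lean`, and the
limit to the kernel series using the Cheeger–Yau lower bound).

Everything here is proved; no facts and no `Prop`-valued definitions are introduced.
-/

noncomputable section

open scoped BigOperators Topology MeasureTheory ENNReal NNReal
open Set Function MeasureTheory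
open Literature.Geometry.Riemannian.SphericalCylinderEntropy (cylEntropy cylDensity cylKernel zonal wt gegen
  cylKernel_eq abs_sum_mul_le_one hausdorffMeasure_sphere_four_pos hausdorffMeasure_sphere_four_lt_top)
open Literature.Geometry.Manifold.CylinderSlice (sliceMap range_sliceMap)

set_option linter.dupNamespace false

namespace Summit.SmoothPoincare4.SmoothPoincare4.Theorems.ThinCrossSectionExists.BallMassSlack

/-- **Stub `hamiltonConvex`** (Hamilton's matrix Harnack estimate for the heat kernel of the round
`S⁴`, radial form): for every `τ > 0`, `θ ↦ zonal τ (cos θ)` is positive and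
`θ ↦ log (zonal τ (cos θ)) + θ²/(4τ)` is convex on `[-π, π]`.
[cite: Hamilton1993Harnack, Main Theorem and p. 114] -/
theorem stub_hamiltonConvex :
    ∀ τ : ℝ, 0 < τ →
        (∀ θ : ℝ, 0 < zonal τ (Real.cos θ)) ∧
          ConvexOn ℝ (Set.Icc (-Real.pi) Real.pi)
            (fun θ : ℝ => Real.log (zonal τ (Real.cos θ)) + θ ^ 2 / (4 * τ)) :=
  Literature.Geometry.Riemannian.SphericalZonalKernelSeries.hamiltonLogConvex_zonal

end Summit.SmoothPoincare4.SmoothPoincare4.Theorems.ThinCrossSectionExists.BallMassSlack
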